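import Literature.MathematicalPhysics.QuantumFieldTheory.Balaban1983to89.Node00.N03Record
import Summits.QuantumFields.YangMills.Theorems.BalabanUVNodesN04AtRecord

/-!
# BalabanUVNodes ∕ N03 — the K2 stub `S_N03 Rec` of `BalabanUVNodesClustersCore` AT NODE 00's RECORD PREDICATES: the CLOSERS OF RECORD
# (refinement-generic over Stage 5, stage-generic on the world side, instances ₅ ∕ ₅C ∕ ₇C ∕ ₈C), vacuity guards at the C-bound records,
# the node UNFOLDED at a record's run, and K2 «FlowBounds» minus N03
# (Track A, DAG node N03 = [B6, Balaban1984PropagatorsII] CMP 96:223, Lemma 2.1 – Cor. 2.8 pp. 234–249; count-neutral)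

HONEST FRAMING.  Count-neutral kernel BOOKKEEPING over landed theorems, by name; no estimate of Bałaban's is re-derived here.  N03 is
DISCHARGED OF RECORD (pub-ymgap chair R443) on `Node00.N03_at_record₃` (`Node00/N03Record.lean`, seats dag-p1 = n03-a, dag-n03-b, dag-n02-b) + referee
reads; this module changes nothing of that.  One finite four-torus programme at fixed `ε`; nothing continuum ∕ ℝ⁴ ∕ OS ∕ mass-gap ∕ Clay.  0 `def`, 0
`sorry`, standard axioms.

WHAT THIS MODULE IS.  The cluster file `BalabanUVNodesClustersCore` (p416552; imported through the N04 module) types the K2 stub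
`YMDAG.UVSplit.S_N03 Rec := AtRecord Rec Dag.B6_main` («b4 → b5 → b6» at every run of every record pair) over a record-predicate PARAMETER `Rec : RecordPred N`.
By the route's ONE WRITER's word (W2) on pub-ymgap dag-lead's DEDUP №15 (2026-08-26) the per-node «AT-RECORD» module IS the node's CLOSER OF RECORD (the
dagwriter's staged supply module «Stages», carrying `stub_N03_of_stage3_of_leaf ∕ _of_prop26`, is HELD); this is the N03 twin of `BalabanUVNodesN04AtRecord.lean`
(p417731), in the same shape:
* §1 `s_N03_iff` (the stub unfolded), `s_N03_antitone`, `s_N03_of_leaf_b6`, and the REFINEMENT-GENERIC closers `s_N03_of_refines₅` ∕ `s_N03_of_refines₅C`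
  (`S_N03 Rec` for EVERY `Rec` refining NODE 00's Stage-5 record predicate, N- resp. C-binding — `Node00.N03_at_record₅ ∕ ₅C` BY NAME; each later stage
  `₇C ∕ ₈C ∕ ₉C ∕ …` closes by ONE application to node00-def's refinement lemma).
* §2 VACUITY GUARDS AT THE C-BOUND RECORDS (referee standard A5): at every run of every `₅C ∕ ₇C ∕ ₈C` record the in-edge leaves `b4`, `b5` are INHABITED
  (`Node00.b4_main_of_isRecordOfRecord₅C` IS the leaf `b4`; `N04AtRecord.leaf_b5_of_isRecordOfRecord₅C` — one tree statement, cited) and N03's own leaf `b6`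
  holds OUTRIGHT — through `Node00.rebind_of_isRecordOfRecord₅C` to a Stage-3 world of record and `Node00.N03_leaf_b6_at_record₃` BY NAME (the C-binding
  touches `b10` only).
* §3 THE NODE UNFOLDED AT A C-BOUND RECORD'S RUN: for the witnessing `θ : Node00.Stage5Params F N` (`w.up P = upOfRecord₅C θ P`), `Dag.B6_main (leavesP w P)`
  IS «`b4` → `b5` → `B6BlockParam (D6OfRecord θ.toStage3Params)`» (the dossier's `Node00.N03_iff_b4_b5_imp_leaf₃` transported), hence IS the eight-fold
  conjunction Lemma 2.1 (parameter form) ∧ Prop. 2.2 ∧ … ∧ Cor. 2.8 at the k-level tower block of record (`Node00.N03_leaf_iff_legs`, `Iff.rfl`).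
* §4 K2 «FlowBounds» MINUS N03: given `S_N03 Rec` (any `Rec`), `FlowBounds Rec` is EQUIVALENT to «N06 ∧ N10 ∧ N09 ∧ N11 ∧ N13 at every run».
* §5 INHABITED-AT-₈C WITH THE GUARDS (`Node00.Record8Inhabited.exists_isRecordOfRecord₈C` — a DEGENERATE zero-chart typing witness, not an object of
  record; chair R445 (A)).
* §6 THE CLOSERS OF RECORD: stage-generic `s_N03_of_refines₃` on the world side and the instances `s_N03_record₅ ∕ ₅C ∕ ₇C ∕ ₈C`.
* §7 (W2′) SHADOW-FORM CLOSERS `s_N03_of_shadow₅C ∕ ₅` + `guards_of_shadow₅C` (v1.1, append-only): the face reads the WORLD only, so a Stage-5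
  record at the same world with ANY shadow datum closes it — the form that fires at the rev-1 stage ₉C through
  `Node00.exists_isRecordOfRecord₅C_of_isRecordOfRecord₉C`.
Sources: T. Bałaban, CMP **96** (1984) 223–250 [Balaban1984PropagatorsII] Lemma 2.1 (2.60)–(2.61) p. 234, Props. 2.2–2.3 pp. 234–238, Lemma 2.4 (2.128) p. 245,
Props. 2.5–2.7 pp. 246–249, Cor. 2.8 p. 249; CMP **89** (1983) 571 [Balaban1983RegularityDecay] and CMP **95** (1984) 17 [Balaban1984PropagatorsI] (the in-edges);
the record dictionaries of [Balaban1987RG1] (0.17)–(0.22) pp. 255–256 and [Balaban1989LargeFieldII] Thm 1 p. 355.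
-/

namespace Summit.QuantumFields.YangMills.BalabanUVNodes.N03AtRecord

open Literature.MathematicalPhysics.QuantumFieldTheory.Balaban1983to89
open Literature.MathematicalPhysics.QuantumFieldTheory.Balaban1983to89.Node00
open Literature.MathematicalPhysics.QuantumFieldTheory.Balaban1983to89.T4Continuum (T4Family FiniteEpsData)
open Literature.MathematicalPhysics.QuantumFieldTheory.Balaban1983to89.DagBinding (WorldP leavesP Upstream B6BlockParam B6Lemma21Param)
open YMDAG.UVSplit (RecordPred Datum AtRecord S_N03 S_N06 S_N09 S_N10 S_N11 S_N13 FlowBounds)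

variable {N : ℕ} [NeZero N]

/-! ## §1 The stub unfolded; antitone in `Rec`; from the leaf; REFINEMENT-GENERIC closers over Stage 5 -/

/-- **What `S_N03 Rec` says** (`Iff.rfl`): at every run of every binding world of every record pair, the in-edge leaves `b4` ([Balaban1983RegularityDecay]) and
`b5` ([Balaban1984PropagatorsI]) imply N03's leaf `b6` ([Balaban1984PropagatorsII] Lemma 2.1 – Cor. 2.8 as bound by the world's upstream block).
[cite: Balaban1984PropagatorsII, pp.234–249 (the node's content; bookkeeping)] -/
theorem s_N03_iff (Rec : RecordPred N) :
    S_N03 Rec ↔ ∀ (F : T4Family) (D : Datum F N) (w : WorldP), Rec F D w → ∀ P : B12.RunParams,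
      (leavesP w P).b4 → (leavesP w P).b5 → (leavesP w P).b6 :=
  Iff.rfl

/-- **`S_N03` is ANTITONE in the record predicate** (every later NODE 00 stage and the route's γ-lowered re-letterings inherit it).
[cite: Balaban1984PropagatorsII, pp.234–249 (bookkeeping)] -/
theorem s_N03_antitone {Rec Rec' : RecordPred N}
    (hle : ∀ (F : T4Family) (D : Datum F N) (w : WorldP), Rec' F D w → Rec F D w) (h : S_N03 Rec) : S_N03 Rec' :=
  fun F D w hR P => h F D w (hle F D w hR) P

/-- `S_N03 Rec` from N03's OWN LEAF at the record (the in-edges are not consumed; no ex-falso route through `b4`, `b5`).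
[cite: Balaban1984PropagatorsII, pp.234–249 (bookkeeping)] -/
theorem s_N03_of_leaf_b6 (Rec : RecordPred N)
    (h : ∀ (F : T4Family) (D : Datum F N) (w : WorldP), Rec F D w → ∀ P : B12.RunParams, (leavesP w P).b6) : S_N03 Rec :=
  fun F D w hR P _ _ => h F D w hR P

/-- **REFINEMENT-GENERIC CLOSER, N-binding**: `S_N03 Rec` for EVERY record predicate refining `Node00.IsRecordOfRecord₅` (`Node00.N03_at_record₅` BY NAME —
hypothesis-free, the Prop. 2.6 census closed by `N03_prop26_census`). [cite: Balaban1984PropagatorsII, Lemma 2.1 – Cor. 2.8 pp.234–249 (kernel versions at the objects of record, Stage 5)] -/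
theorem s_N03_of_refines₅ (Rec : RecordPred N)
    (hR : ∀ (F : T4Family) (D : Datum F N) (w : WorldP), Rec F D w → IsRecordOfRecord₅ F N D w) : S_N03 Rec :=
  fun F D w h P => N03_at_record₅ (hR F D w h) P

/-- **REFINEMENT-GENERIC CLOSER, C-binding**: `S_N03 Rec` for EVERY record predicate refining the record predicate of record `Node00.IsRecordOfRecord₅C`
(`Node00.N03_at_record₅C` BY NAME) — `₇C ∕ ₈C ∕ ₉C ∕ …` close by one application each.
[cite: Balaban1984PropagatorsII, Lemma 2.1 – Cor. 2.8 pp.234–249 (kernel versions at the objects of record, C-binding)] -/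
theorem s_N03_of_refines₅C (Rec : RecordPred N)
    (hR : ∀ (F : T4Family) (D : Datum F N) (w : WorldP), Rec F D w → IsRecordOfRecord₅C F N D w) : S_N03 Rec :=
  fun F D w h P => N03_at_record₅C (hR F D w h) P

/-! ## §2 VACUITY GUARDS at the C-bound records: in-edges `b4`, `b5` INHABITED, leaf `b6` OUTRIGHT (₅C, hence ₇C, ₈C) -/

section Guards

variable {F : T4Family} {D : FiniteEpsData F (SU N)} {w : WorldP}

/-- **Conclusion side, ₅C**: at every run of a Stage-5 (C-bound) record N03's own leaf `b6` holds OUTRIGHT (the in-edges are NOT consumed): the literal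
re-binding of the world to the N-binding over the same carriers is a Stage-3 world of record (`Node00.rebind_of_isRecordOfRecord₅C`), where
`Node00.N03_leaf_b6_at_record₃` applies; the C-binding leaves `b6` untouched (`Node00.upOfRecord₅C_leaves`, `rfl`).
[cite: Balaban1984PropagatorsII, Lemma 2.1 – Cor. 2.8 pp.234–249 (kernel versions of the lineages at the objects of record)] -/
theorem leaf_b6_of_isRecordOfRecord₅C (h : IsRecordOfRecord₅C F N D w) (P : B12.RunParams) : (leavesP w P).b6 := by
  obtain ⟨θ, -, hup, h3, -⟩ := rebind_of_isRecordOfRecord₅C h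
  have h6 : (upOfRecord₅ F N θ P).b6 := N03_leaf_b6_at_record₃ _ h3 P
  show (w.up P).b6
  rw [hup P]
  exact h6

/-- **Both in-edges, the leaf and the node at once, ₅C**: `b4` (N01 is a NODE 00 theorem at the record: `Node00.b4_main_of_isRecordOfRecord₅C` IS the leaf), `b5`
(the N04 module's `N04AtRecord.leaf_b5_of_isRecordOfRecord₅C`, by name), `b6` (outright) and the node (`Node00.N03_at_record₅C`).
[cite: Balaban1983RegularityDecay, Theorem p.573; Balaban1984PropagatorsI, Props. 1.1–1.2 pp.33–36; Balaban1984PropagatorsII, pp.234–249 (kernel versions at the objects of record; bookkeeping)] -/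
theorem guards_of_isRecordOfRecord₅C (h : IsRecordOfRecord₅C F N D w) (P : B12.RunParams) :
    (leavesP w P).b4 ∧ (leavesP w P).b5 ∧ (leavesP w P).b6 ∧ Dag.B6_main (leavesP w P) :=
  ⟨b4_main_of_isRecordOfRecord₅C h P, N04AtRecord.leaf_b5_of_isRecordOfRecord₅C h P, leaf_b6_of_isRecordOfRecord₅C h P, N03_at_record₅C h P⟩

/-- Leaf `b6` outright at every run of a Stage-7 record (refinement `₇C → ₅C`). [cite: Balaban1984PropagatorsII, pp.234–249 (bookkeeping)] -/
theorem leaf_b6_of_isRecordOfRecord₇C (h : IsRecordOfRecord₇C F N D w) (P : B12.RunParams) : (leavesP w P).b6 :=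
  leaf_b6_of_isRecordOfRecord₅C (isRecordOfRecord₅C_of_isRecordOfRecord₇C h) P

/-- Both in-edges, the leaf and the node at once, ₇C. [cite: Balaban1984PropagatorsII, pp.234–249 (bookkeeping)] -/
theorem guards_of_isRecordOfRecord₇C (h : IsRecordOfRecord₇C F N D w) (P : B12.RunParams) :
    (leavesP w P).b4 ∧ (leavesP w P).b5 ∧ (leavesP w P).b6 ∧ Dag.B6_main (leavesP w P) :=
  guards_of_isRecordOfRecord₅C (isRecordOfRecord₅C_of_isRecordOfRecord₇C h) P

/-- Leaf `b6` outright at every run of a Stage-8 record (refinement `₈C → ₅C`; the leaf is chart-free, so the zero-chart members of the ₈C class are no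
exception). [cite: Balaban1984PropagatorsII, pp.234–249 (bookkeeping)] -/
theorem leaf_b6_of_isRecordOfRecord₈C (h : IsRecordOfRecord₈C F N D w) (P : B12.RunParams) : (leavesP w P).b6 :=
  leaf_b6_of_isRecordOfRecord₅C (isRecordOfRecord₅C_of_isRecordOfRecord₈C h) P

/-- Both in-edges, the leaf and the node at once, ₈C. [cite: Balaban1984PropagatorsII, pp.234–249 (bookkeeping)] -/
theorem guards_of_isRecordOfRecord₈C (h : IsRecordOfRecord₈C F N D w) (P : B12.RunParams) :
    (leavesP w P).b4 ∧ (leavesP w P).b5 ∧ (leavesP w P).b6 ∧ Dag.B6_main (leavesP w P) :=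
  guards_of_isRecordOfRecord₅C (isRecordOfRecord₅C_of_isRecordOfRecord₈C h) P

end Guards

/-! ## §3 THE NODE UNFOLDED AT A C-BOUND RECORD'S RUN: «b4 → b5 → `B6BlockParam (D6OfRecord θ)`» = the eight legs -/

section Unfolded

variable {F : T4Family} (θ : Stage5Params F N) {w : WorldP} (P : B12.RunParams)

/-- **The node at a run of a C-bound record, UNFOLDED** (no admissibility needed): if the run's upstream block is the C-binding of record at `θ`
(`w.up P = upOfRecord₅C θ P`), then `Dag.B6_main (leavesP w P)` IS «`b4` → `b5` (of that run) → `B6BlockParam (D6OfRecord θ.toStage3Params)`», the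
parameter-form [Balaban1984PropagatorsII] block on the k-level tower block of record — the dossier's `Node00.N03_iff_b4_b5_imp_leaf₃` at the record's
Stage-3 bundle, the C-binding leaving `b4`, `b5`, `b6` untouched (`rfl`). [cite: Balaban1984PropagatorsII, pp.223–250 (dictionary: what the node asserts at the objects of record, C-binding)] -/
theorem b6_main_iff_of_up₅C (hP : w.up P = upOfRecord₅C F N θ P) :
    Dag.B6_main (leavesP w P) ↔ ((leavesP w P).b4 → (leavesP w P).b5 → B6BlockParam (D6OfRecord θ.toStage3Params)) := by
  have hb6 : (leavesP w P).b6 ↔ B6BlockParam (D6OfRecord θ.toStage3Params) := by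
    show (w.up P).b6 ↔ _
    rw [hP]
    exact Iff.rfl
  show ((leavesP w P).b4 → (leavesP w P).b5 → (leavesP w P).b6) ↔ _
  rw [hb6]

/-- **… as the EIGHT LEGS** (admissible `θ`, so the in-edges `b4`, `b5` of the run hold and drop out — `carriers₁_b4 ∕ b5` through the record's bundle): at a
C-bound record's run the node statement IS Lemma 2.1 (parameter form) ∧ Prop. 2.2 ∧ Prop. 2.3 ∧ Lemma 2.4 ∧ Prop. 2.5 ∧ Prop. 2.6 ∧ Prop. 2.7 ∧ Cor. 2.8
at the block of record `D6OfRecord θ.toStage3Params` (`Node00.N03_leaf_iff_legs`, `Iff.rfl`).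
[cite: Balaban1984PropagatorsII, Lemma 2.1 p.234, Props. 2.2–2.3 pp.234–238, Lemma 2.4 p.245, Props. 2.5–2.7 pp.246–249, Cor. 2.8 p.249 (dictionary at the objects of record, in-edges consumed)] -/
theorem b6_main_iff_legs_of_up₅C (hθ : θ.Admissible) (hP : w.up P = upOfRecord₅C F N θ P) :
    Dag.B6_main (leavesP w P) ↔
      B6Lemma21Param (D6OfRecord θ.toStage3Params) ∧
        B6.Prop22Printed (D6OfRecord θ.toStage3Params).geo (D6OfRecord θ.toStage3Params).Gp ∧
        B6.Prop23Printed (D6OfRecord θ.toStage3Params).d (D6OfRecord θ.toStage3Params).geo (D6OfRecord θ.toStage3Params).Cinv ∧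
        B6.Lemma24Printed (D6OfRecord θ.toStage3Params).d (D6OfRecord θ.toStage3Params).L (D6OfRecord θ.toStage3Params).tree ∧
        B6.Prop25Printed (D6OfRecord θ.toStage3Params).loc ∧
        B6.Prop26Printed (D6OfRecord θ.toStage3Params).geo (D6OfRecord θ.toStage3Params).G ∧
        B6.Prop27Printed (D6OfRecord θ.toStage3Params).d (D6OfRecord θ.toStage3Params).geo (D6OfRecord θ.toStage3Params).Qinv ∧
        B6.Cor28Printed (D6OfRecord θ.toStage3Params).d (D6OfRecord θ.toStage3Params).geo (D6OfRecord θ.toStage3Params).H := by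
  rw [b6_main_iff_of_up₅C θ P hP, ← N03_leaf_iff_legs]
  have hb4 : (leavesP w P).b4 := by
    show (w.up P).b4
    rw [hP]
    exact carriers₁_b4 θ.toStage1Params hθ.1 (withB7OfRecord (withB6KOfRecord (θ.res.X P) θ.toStage3Params) θ.D θ.L θ.𝔸)
      (θ.res.Y P) (θ.res.Z P) (θ.res.V P) (θ.res.W P)
  have hb5 : (leavesP w P).b5 := by
    show (w.up P).b5
    rw [hP]
    exact carriers₁_b5 θ.toStage1Params hθ.1 (withB7OfRecord (withB6KOfRecord (θ.res.X P) θ.toStage3Params) θ.D θ.L θ.𝔸)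
      (θ.res.Y P) (θ.res.Z P) (θ.res.V P) (θ.res.W P)
  exact ⟨fun h => h hb4 hb5, fun h _ _ => h⟩

/-- **At a ₈C record the node IS the parameter-form block at the witness's tower block**: for the record's witnessing parameters (re-lettered to Stage 5)
every run unfolds to `B6BlockParam (D6OfRecord θ.toStage3Params)` — nothing hides behind the binding at the intermediate-terminal stage.
[cite: Balaban1984PropagatorsII, pp.223–250 (dictionary at the objects of record, Stage 8)] -/
theorem exists_leaf_iff_of_isRecordOfRecord₈C {D : FiniteEpsData F (SU N)} (h : IsRecordOfRecord₈C F N D w) :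
    ∃ θ : Stage5Params F N, θ.Admissible ∧ D = datumOfRecord₅ F N θ ∧ ∀ P : B12.RunParams,
      (Dag.B6_main (leavesP w P) ↔ B6BlockParam (D6OfRecord θ.toStage3Params)) := by
  obtain ⟨θ, hθ, hD, -, -, -, hup⟩ := isRecordOfRecord₅C_of_isRecordOfRecord₈C h
  refine ⟨θ, hθ, hD, fun P => ?_⟩
  rw [b6_main_iff_legs_of_up₅C θ P hθ (hup P), ← N03_leaf_iff_legs]

end Unfolded

/-! ## §4 K2 «FlowBounds» MINUS N03 -/

/-- **K2 with the N03 conjunct DROPPED BY THEOREM** (generic in `Rec`): whenever `S_N03 Rec` holds (every `Rec` refining Stage 3 on the world side — §6; every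
`Rec` refining Stage 5 — §1), `FlowBounds Rec` is EQUIVALENT to «N06 ∧ N10 ∧ N09 ∧ N11 ∧ N13 at every run of every record world».  N03 is never the
obstruction of K2. [cite: Balaban1984PropagatorsII, pp.234–249 (bookkeeping over the cluster statement)] -/
theorem flowBounds_iff_of_s_N03 (Rec : RecordPred N) (h03 : S_N03 Rec) :
    FlowBounds Rec ↔
      AtRecord Rec fun ℓ => Dag.B9_main ℓ ∧ Dag.B13_main ℓ ∧ Dag.B12_main ℓ ∧ Dag.B14_main ℓ ∧ Dag.B16_main ℓ := by
  constructor
  · intro h F D w hR P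
    exact (h F D w hR P).2
  · intro h F D w hR P
    exact ⟨h03 F D w hR P, h F D w hR P⟩

/-- **K2 from its OTHER five stubs** at any `Rec` refining the record predicate of record `IsRecordOfRecord₅C` (N03 supplied by §1; N06, N10, N09, N11, N13 are
hypotheses — the route's items, displayed, not asserted; the landed join is `YMDAG.UVSplit.FlowBounds_of`, p417201).
[cite: Balaban1984PropagatorsII, pp.234–249 (bookkeeping over the cluster statement)] -/
theorem flowBounds_of_rest_of_refines₅C (Rec : RecordPred N)
    (hR : ∀ (F : T4Family) (D : Datum F N) (w : WorldP), Rec F D w → IsRecordOfRecord₅C F N D w)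
    (h06 : S_N06 Rec) (h10 : S_N10 Rec) (h09 : S_N09 Rec) (h11 : S_N11 Rec) (h13 : S_N13 Rec) : FlowBounds Rec :=
  (flowBounds_iff_of_s_N03 Rec (s_N03_of_refines₅C Rec hR)).2 fun F D w h P =>
    ⟨h06 F D w h P, h10 F D w h P, h09 F D w h P, h11 F D w h P, h13 F D w h P⟩

/-! ## §5 INHABITED-AT-₈C with the guards (typing witness; DEGENERATE zero-chart record — chair R445 (A)) -/

/-- **INHABITED-AT-₈C, WITH N03's GUARDS**: on every four-torus family and every `N ≥ 1` there is a Stage-8 record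
(`Node00.Record8Inhabited.exists_isRecordOfRecord₈C` — the zero-chart typing witness, DEGENERATE, not an object of record), and at each of its runs the in-edge
leaves `b4`, `b5` hold, N03's leaf `b6` holds outright, and the node holds. [cite: Balaban1987RG1, (0.17)–(0.22) pp.255–256; Balaban1984PropagatorsII, pp.234–249 (bookkeeping witness + kernel versions at it)] -/
theorem inhabited₈C_with_guards (F : T4Family) :
    ∃ (D : FiniteEpsData F (SU N)) (w : WorldP), IsRecordOfRecord₈C F N D w ∧
      ∀ P : B12.RunParams, (leavesP w P).b4 ∧ (leavesP w P).b5 ∧ (leavesP w P).b6 ∧ Dag.B6_main (leavesP w P) := by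
  obtain ⟨D, w, h⟩ := Record8Inhabited.exists_isRecordOfRecord₈C F N
  exact ⟨D, w, h, fun P => guards_of_isRecordOfRecord₈C h P⟩

/-- The same at the record predicate of record ₅C (through `₈C → ₅C`). [cite: Balaban1989LargeFieldII, Thm 1 p.355 (bookkeeping witness)] -/
theorem inhabited₅C_with_guards (F : T4Family) :
    ∃ (D : FiniteEpsData F (SU N)) (w : WorldP), IsRecordOfRecord₅C F N D w ∧
      ∀ P : B12.RunParams, (leavesP w P).b4 ∧ (leavesP w P).b5 ∧ (leavesP w P).b6 ∧ Dag.B6_main (leavesP w P) := by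
  obtain ⟨D, w, h, hg⟩ := inhabited₈C_with_guards (N := N) F
  exact ⟨D, w, isRecordOfRecord₅C_of_isRecordOfRecord₈C h, hg⟩

/-! ## §6 THE CLOSERS OF RECORD (plan's word (W2) on dag-lead's DEDUP №15): the stage-generic closer on the world side and the INSTANCES at NODE 00's
## landed record predicates ₅ ∕ ₅C ∕ ₇C ∕ ₈C — each ONE application -/

/-- `S_N03 Rec` for every `Rec` refining Stage 3 on the world side (`Node00.N03_at_record₃` BY NAME — the count's theorem of record, R443;
= `Node00.N03_atRecord_of_refines₃` in the cluster file's vocabulary). [cite: Balaban1984PropagatorsII, Lemma 2.1 – Cor. 2.8 pp.234–249 (kernel versions at the objects of record, Stage 3)] -/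
theorem s_N03_of_refines₃ (Rec : RecordPred N)
    (hR : ∀ (F : T4Family) (D : Datum F N) (w : WorldP), Rec F D w → IsWorldOfRecord₃ w) : S_N03 Rec :=
  fun F D w h P => N03_at_record₃ w (hR F D w h) P

/-- N03 at NODE 00's Stage-5 record predicate, N-binding. [cite: Balaban1984PropagatorsII, Lemma 2.1 – Cor. 2.8 pp.234–249 (kernel versions at the objects of record)] -/
theorem s_N03_record₅ : S_N03 (N := N) fun F D w => IsRecordOfRecord₅ F N D w :=
  s_N03_of_refines₅ _ fun _ _ _ h => h

/-- N03 at NODE 00's record predicate of record ₅C (C-binding). [cite: Balaban1984PropagatorsII, Lemma 2.1 – Cor. 2.8 pp.234–249 (kernel versions at the objects of record)] -/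
theorem s_N03_record₅C : S_N03 (N := N) fun F D w => IsRecordOfRecord₅C F N D w :=
  s_N03_of_refines₅C _ fun _ _ _ h => h

/-- N03 at NODE 00's Stage-7 record predicate ₇C. [cite: Balaban1984PropagatorsII, Lemma 2.1 – Cor. 2.8 pp.234–249 (kernel versions at the objects of record)] -/
theorem s_N03_record₇C : S_N03 (N := N) fun F D w => IsRecordOfRecord₇C F N D w :=
  s_N03_of_refines₅C _ fun _ _ _ h => isRecordOfRecord₅C_of_isRecordOfRecord₇C h

/-- N03 at NODE 00's Stage-8 record predicate ₈C (the leaf is chart-free: the zero-chart members of the class are no exception, R445 (A)).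
[cite: Balaban1984PropagatorsII, Lemma 2.1 – Cor. 2.8 pp.234–249 (kernel versions at the objects of record)] -/
theorem s_N03_record₈C : S_N03 (N := N) fun F D w => IsRecordOfRecord₈C F N D w :=
  s_N03_of_refines₅C _ fun _ _ _ h => isRecordOfRecord₅C_of_isRecordOfRecord₈C h

/-! ## §7 (W2′) SHADOW-FORM CLOSERS — the node's face reads the WORLD only, so a ₅C record AT THE SAME WORLD with ANY (shadow) datum closes it
(plan's rider (W2′) on (W2), pub-ymgap 2026-08-26: at the rev-1 terminal stage ₉C the refinement to ₅C holds at a SHADOW datum `D₅` with the same binding world,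
`Node00.exists_isRecordOfRecord₅C_of_isRecordOfRecord₉C : IsRecordOfRecord₉C F N D w → ∃ D₅, IsRecordOfRecord₅C F N D₅ w ∧ …` — so `s_N03_of_shadow₅C` below fires at
₉C by ONE application, no agreement clause needed, no re-keying of §§1–6; v1.1, append-only) -/

/-- **SHADOW-FORM CLOSER, C-binding**: `S_N03 Rec` for every record predicate each of whose triples `(F, D, w)` admits SOME Stage-5 (C-bound) record `(D₅, w)` AT THE
SAME WORLD — the node's face `Dag.B6_main (leavesP w P)` reads `w` only, never `D` (`Node00.N03_at_record₅C` BY NAME).  At the rev-1 stage: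
`s_N03_of_shadow₅C _ fun F D w h => (Node00.exists_isRecordOfRecord₅C_of_isRecordOfRecord₉C h).imp fun _ h' => h'.1`.
[cite: Balaban1984PropagatorsII, Lemma 2.1 – Cor. 2.8 pp.234–249 (kernel version at the objects of record; bookkeeping over the record-predicate parameter)] -/
theorem s_N03_of_shadow₅C (Rec : RecordPred N)
    (hR : ∀ (F : T4Family) (D : Datum F N) (w : WorldP), Rec F D w → ∃ D₅ : Datum F N, IsRecordOfRecord₅C F N D₅ w) : S_N03 Rec :=
  fun F D w h P => by
    obtain ⟨D₅, h₅⟩ := hR F D w h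
    exact N03_at_record₅C h₅ P

/-- **SHADOW-FORM CLOSER, N-binding** (a Stage-5 N-bound record at the same world, any shadow datum; `Node00.N03_at_record₅`).
[cite: Balaban1984PropagatorsII, Lemma 2.1 – Cor. 2.8 pp.234–249 (kernel version at the objects of record; bookkeeping)] -/
theorem s_N03_of_shadow₅ (Rec : RecordPred N)
    (hR : ∀ (F : T4Family) (D : Datum F N) (w : WorldP), Rec F D w → ∃ D₅ : Datum F N, IsRecordOfRecord₅ F N D₅ w) : S_N03 Rec :=
  fun F D w h P => by
    obtain ⟨D₅, h₅⟩ := hR F D w h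
    exact N03_at_record₅ h₅ P

/-- **The A5 guards in shadow form**: at every run of a world carrying SOME Stage-5 (C-bound) record, the in-edge leaves, the node's leaf `b6` and the node
hold (`guards_of_isRecordOfRecord₅C` at the shadow datum — every conjunct reads `w` only). [cite: Balaban1984PropagatorsII, Lemma 2.1 – Cor. 2.8 pp.234–249 (bookkeeping)] -/
theorem guards_of_shadow₅C {F : T4Family} {w : WorldP} (h : ∃ D₅ : FiniteEpsData F (SU N), IsRecordOfRecord₅C F N D₅ w) (P : B12.RunParams) :
    (leavesP w P).b4 ∧ (leavesP w P).b5 ∧ (leavesP w P).b6 ∧ Dag.B6_main (leavesP w P) := by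
  obtain ⟨D₅, h₅⟩ := h
  exact guards_of_isRecordOfRecord₅C h₅ P

end Summit.QuantumFields.YangMills.BalabanUVNodes.N03AtRecord
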